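import Mathlib
import HarnessLib
import HarnessLib.Audit
import Summits.NavierStokesRegularity.Statement
import Literature.Analysis.FluidPDE.AxisymmetricEuler
import Literature.Analysis.FluidPDE.ClassicalSolution
import Literature.Analysis.FluidPDE.LerayHopf
import Literature.Analysis.FluidPDE.SelfSimilarLiouville
import Summits.NavierStokesRegularity.NavierStokesRegularity.Theorems.BlowupAssembly
import Summits.NavierStokesRegularity.NavierStokesRegularity.Theorems.CertifiedBlowupAssembly
import Summits.NavierStokesRegularity.NavierStokesRegularity.Theorems.CertifiedBlowupKillEdge
import Summits.NavierStokesRegularity.NavierStokesRegularity.Theorems.CertifiedBlowupProfileData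
import Summits.NavierStokesRegularity.NavierStokesRegularity.Theorems.CertifiedBlowupConditions
import Summits.NavierStokesRegularity.NavierStokesRegularity.Theorems.AdiabaticEddyClayUniqueness
import HarnessLib.Audit.Status.Attr

/-!
Route: CertifiedBlowup

DORMANT since 2026-09-01T12:52:31Z (reconciler: no traction for 5 d (last activity statement-checked at 2026-08-27T12:19:12Z); parked, not closed — `ledger route dormant route-NavierStokesRegularity-CertifiedBlowup --off` to reactivate) — unstaffed, not closed; items shared with open routes are served there. `ledger route dormant <id> --off` reactivates.

# Route CertifiedBlowup — NEGATIVE side — ¬(Clay A) from a certified axisymmetric interior blow-up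
(X5a_axi) plus Clay-class uniqueness (X5b)

It suffices to show X := X5a_axi ∧ X5b (target CertifiedBlowupThesisV2). X5a_axi (crux #2,
CertifiedBlowupAxisymBlowup): for
some ν > 0 the Leray–Hopf classical solution of Navier–Stokes on ℝ³ from some rapidly decaying
AXISYMMETRIC datum is maximal
with finite lifespan T — Hou's interior "tornado" scenario (arXiv:2107.06509), the intended target
of a Chen–Hou-type
computer-assisted proof. X5b (support BlowupClayUniqueness, shared verbatim with route Blowup): a
smooth bounded-energy Clay
solution from a rapidly decaying datum coincides on [0,T) with the Leray–Hopf classical solution.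
The METHOD for X5a_axi is
typed by the rate signature every bounded-profile dynamic-rescaling certificate forces: crux #3
CertifiedBlowupVorticityRateBlowup
((T−t)‖ω(t)‖_∞ ≤ C near T: vorticity-Type-I, velocity-Type-II) and its typed negation crux #4
CertifiedBlowupVorticityRateExclusion form a prove-or-kill dichotomy (support
CertifiedBlowupRateDichotomy: #4 ↔ ¬#3;
support CertifiedBlowupRateGlue: #3 → #2). Negative side: the deciding theorem concludes
¬NavierStokesRegularity.
Lean: `CertifiedBlowupThesisV2` — i.e. `(∃ ν > 0, ∃ T > 0, ∃ u p, IsMaximalSmoothSolution ν 0 u p T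
∧ IsLerayHopfOn T ν 0 (u 0) u ∧ HasRapidSpatialDecay (u 0) ∧ IsAxisymmetric (u 0)) ∧
<BlowupClayUniqueness>` over Literature.Analysis.FluidPDE.{IsMaximalSmoothSolution, IsLerayHopfOn,
HasRapidSpatialDecay, IsAxisymmetric, IsSmoothOnHalfSpace, IsNavierStokesSolution, HasBoundedEnergy,
IsClassicalNSSolutionOn} (all `lean search --decl`-verified; planner Sketch.lean elaborates, lean
check rc 0)

## Assembly
Pure logic plus the field-for-field identity of the Clay predicates with IsClassicalNSSolutionOn
(Ici 0): from the X5a_axi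
witness (ν,T,u,p) apply Clay (A) to the datum u 0 (smooth and divergence-free from
IsClassicalNSSolutionOn at t = 0, rapidly
decaying by hypothesis) to get a global smooth bounded-energy (u′,p′); X5b gives u′ = u on [0,T);
restricting (u′,p′) to
Ico 0 (T+1) is a smooth extension of u past T, contradicting maximality. This is the deciding
theorem `closes
(hX : CertifiedBlowupAxisymBlowup) (hU : BlowupClayUniqueness) : ¬ NavierStokesRegularity` (8 lines,
certified native since
rev 3, axioms propext / Classical.choice / Quot.sound; it needs neither Theorems.BlowupAssembly nor
the NSLerayHopf bridge lemma —
the anonymous constructor of IsClassicalNSSolutionOn (Ici 0) suffices). ASSEMBLY ITEMS, CURRENT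
STATE: the route still carries the
two conjunctive assemblies stmt-0151 `Assembly` ((X5a ∧ X5b) → ¬NS, v1, shared with route Blowup)
and stmt-0726 `Assembly2`
((X5a_axi ∧ X5b) → ¬NS, v2), both proved; their replacement by the single curried item
CertifiedBlowupAssembly :=
CertifiedBlowupAxisymBlowup → BlowupClayUniqueness → ¬NavierStokesRegularity (the type of `closes`;
the block below is that
target shape) is PARKED as an operator-gated edit (evidence edit2.json: the gate refuses assembly
drops / kind changes to
planners and bounces every structural edit on route.multi-assembly — see retriage_note).

Rationale: WHY THIS LINE. Certified numerics (interval arithmetic + a-posteriori nonlinear stability in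
dynamic-rescaling variables) is the only
technology that has produced a smooth-data blow-up THEOREM for a 3-D incompressible fluid equation —
ChenHou2022 /
ChenHou2023RigorousNumerics / ChenHou2025 (axisymmetric Euler with boundary; in tree as
Literature.Analysis.FluidPDE.chen_hou_blowup),
after Elgindi2021 — and Hou's constant-geometry NS computation Hou2022PotentiallySingularNS
(arXiv:2107.06509) is the one
printed interior candidate for Navier–Stokes itself; HouWangYang2025 (arXiv:2509.25116) shows CAP
already reaches genuine
3-D NS statements (non-uniqueness). What is imported: validated numerics / computer-assisted proof
methodology (area:
numerical analysis) and the axisymmetric regularity theory KochNadirashviliSereginSverak2009,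
Seregin2020, Seregin2024AxisymTypeII,
Seregin2026 (area: PDE regularity) used AGAINST the construction to type it. The decisive point,
isolated as cruxes #3/#4: for
NS the viscous term is critical under the self-similar scaling, KNSS2009 excludes velocity-Type-I
axisymmetric blow-up and
NRŠ/Tsai exclude exactly self-similar finite-local-energy profiles, so any bounded-profile
certificate is a NEARLY self-similar,
asymptotically inviscid collapse with core scale (T−t)^β, β ∈ [2/5,1/2), vorticity rate (T−t)‖ω‖_∞ ≤
C — a class that
Seregin's Euler-scaling analysis sees as a swirl-free ancient Euler limit but does not yet exclude.
Either #3 (a certificate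
lands in the class) or #4 (the class is empty: every axisymmetric finite-lifespan solution is
super-Type-I in vorticity) is
a theorem worth having; no prior route and nothing in the negatives index types this dichotomy.

RANKED CRUXES. #0 CertifiedBlowupThesisV2 (target) — X := X5a_axi ∧ X5b — finite-time blow-up of the
Leray–Hopf classical solution from some rapidly decaying axisymmetric datum, and Clay-class
uniqueness (verbatim the conjunction of CertifiedBlowupAxisymBlowup and BlowupClayUniqueness).
[deps: CertifiedBlowupAxisymBlowup, BlowupClayUniqueness] [difficulty: open-problem] (why it might
fail: the open conjecture Literature.Analysis.FluidPDE.AxisymmetricSwirlRegularity together with X5b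
refutes X (landed theorem Literature.NS.certifiedBlowup_kill_edge); constant-ν numerics are
inconclusive (Hou2022 sits at the KNSS-forbidden endpoint β = 1/2; Hou2026 alters the equation).)
[KochNadirashviliSereginSverak2009, Hou2022PotentiallySingularNS, Hou2026, Fefferman2000,
arXiv:2107.06509]
#2 CertifiedBlowupAxisymBlowup (crux) — X5a_axi — ∃ ν > 0, T ∈ (0,∞) and a classical NS solution
(u,p) on ℝ³×[0,T), Leray–Hopf on [0,T), with u(0) rapidly decaying AND axisymmetric, admitting no
classical extension past T (Hou's interior nearly self-similar scenario with swirl; no-swirl data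
are globally regular, axisymmetric velocity-Type-I blow-up is excluded, so swirl is essential and
the rate is Type II). [difficulty: open-problem] (why it might fail: NS may simply be regular for
axisymmetric data (conjecture AxisymmetricSwirlRegularity, ns.S25); printed mechanisms stop short:
Elgindi2021 needs C^(1,α) data, ChenHou2025 a boundary, Hou2022's fitted growth sits at the
KNSS-forbidden endpoint β = 1/2, Hou2026 changes the equation.) [KochNadirashviliSereginSverak2009,
Hou2022PotentiallySingularNS, Hou2026, ChenHou2025, Elgindi2021, arXiv:2107.06509]
#3 CertifiedBlowupVorticityRateBlowup (crux) — the CERTIFICATE CLASS — for some ν > 0 a Leray–Hopf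
classical solution from a rapidly decaying axisymmetric datum is maximal with finite lifespan T and
obeys the dynamic-rescaling rate (T−t)‖ω(t)‖_∞ ≤ C as t ↑ T (what any Chen–Hou-type certificate with
bounded rescaled profile and c_ω < 0 delivers). [difficulty: open-problem] (why it might fail:
squeezed into β = c_l/|c_ω| ∈ [2/5,1/2) (energy; KNSS2009 + Seregin2020: no Type I): asymptotically
inviscid, Kelvin's r·u_θ bound makes the Euler-scaling limit swirl-free (Seregin2024AxisymTypeII,
Seregin2026 §4), excluded under his (1.7)+(2.4); Hou2022 sits at β = 1/2.)
[KochNadirashviliSereginSverak2009, Seregin2020, Seregin2024AxisymTypeII, Seregin2026,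
arXiv:2606.29468, Hou2022PotentiallySingularNS, ChenHou2022]
#4 CertifiedBlowupVorticityRateExclusion (crux) — the typed KILL statement (¬#3 up to logic, support
CertifiedBlowupRateDichotomy) — every Leray–Hopf classical solution from a rapidly decaying
axisymmetric datum that is maximal with finite lifespan T is super-Type-I in vorticity: limsup_{t↑T}
(T−t)‖ω(t)‖_∞ = ∞; a strengthening of KNSS2009 (velocity Type I excluded) along Seregin's Euler
scaling. Proved, it empties the certificate class and closes the route
refuted:CertifiedBlowupVorticityRateBlowup. [difficulty: L] (why it might fail: a slow-collapse
scenario β ∈ [2/5,1/2), swirl-free only at leading order (Elgindi-type C^(1,α) Euler limit), passes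
the energy, CKN, KNSS and Kelvin budgets; Seregin2026 Thm 2.1 excludes it only under (1.7)+(2.4) —
otherwise Thm 3.1 just yields a non-trivial ancient Euler limit.) [Seregin2024AxisymTypeII,
Seregin2024, Seregin2026, arXiv:2606.29468, KochNadirashviliSereginSverak2009, LeiZhang2017]
#4 BlowupClayUniqueness (support) — X5b, Clay-class uniqueness (shared verbatim with route Blowup,
stmt-NavierStokesRegularity-0153): a jointly smooth bounded-energy solution of the Clay system from
a rapidly decaying datum coincides on [0,T) with any Leray–Hopf classical solution from the same
datum. Delicate point: Fefferman's class (A) carries no energy inequality and no LPS integrability,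
so Prodi–Serrin weak–strong uniqueness does not apply as printed; a Liouville normalisation of the
pressure comes first. [difficulty: M] (why it might fail: smooth + sup_t ∫|u|² < ∞ gives neither the
global energy inequality nor LPS integrability (u(t) may be unbounded at spatial infinity, ∫∫|∇u|²
may diverge), so weak–strong uniqueness does not apply as printed; the pressure needs a Liouville
normalisation first.) [Fefferman2000, Prodi1959, Serrin1963, LemarieRieusset2016]
#9 CertifiedBlowupRateGlue (support) — #3 → #2 (forget the rate conjunct); pure logic, three lines
(proved in the planner's Sketch.lean). [difficulty: provable-now] [BealeKatoMajda1984]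
#9 CertifiedBlowupRateDichotomy (support) — #4 ↔ ¬#3 (push the negation through ∃ / ∀ᶠ / ∃ᶠ); pure
logic, so that a proof of #4 closes #3 as refuted in one line and vice versa. [difficulty:
provable-now] [KochNadirashviliSereginSverak2009]
#9 CertifiedBlowupEnergyBootstrap (support) — the frame-independent half of the certificate layer
over the landed package (Chen–Hou Part I, Lemma A.2, energy form): under
Literature.NS.BlowupProfileConditions d F there is a threshold E* > 0 such that every trajectory v :
[0,∞) → F.X staying in F.unstableᗮ, whose energy ‖v‖²/2 has a derivative within [0,∞) bounded by
linForm + Σ nonlinForms + ⟪residual, v⟫, and with ‖v 0‖ < E*, satisfies ‖v τ‖ < E* for all τ ≥ 0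
(continuity / first-exit argument). [difficulty: provable-now] [ChenHou2022,
ChenHou2023RigorousNumerics]

TWO-LAYER PLAN. Crux #3 CertifiedBlowupVorticityRateBlowup ⇐ C1 → C2 → #3 with C1 = CERTIFICATE (∃ d
: Literature.NS.BlowupProfileData, Conditions_ns d,
discharged as V.claim c h by a sound interval-arithmetic
Literature.Analysis.ValidatedNumerics.Verifier and an explicit certificate
computed externally à la Hou arXiv:2107.06509 / Chen–Hou arXiv:2210.07191, arXiv:2305.05660) and C2
= ANALYTIC (∀ d, Conditions_ns d → #3:
nonlinear stability of the approximate nearly self-similar profile in dynamic-rescaling coordinates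
WITH critical viscosity, plus
cylinder → ℝ³ portability, the latter shared with route RobustBlowupPortability); glue C1 → C2 → #3
is one line. Both wait for a
CANONICAL functional frame nsFrame (weights, norms, rank of the unstable projection):
Theorems/CertifiedBlowupRefutations.lean shows
that any typing with the frame quantified is vacuous, which is why the informal items 0269/0270/0271
(and the v1 thesis 0268) carry
no Lean statement, are slated for drop in the parked operator-gated edit, and live here meanwhile.
#2 ⇐ #3 is already the support item CertifiedBlowupRateGlue.

KILL CRITERIA. - #4 CertifiedBlowupVorticityRateExclusion proved ⇒ #3 refuted in one line
(CertifiedBlowupRateDichotomy) ⇒ close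
  `--reason refuted:CertifiedBlowupVorticityRateBlowup`: the bounded-profile certificate class is
empty; a vorticity-Type-II
  (modulated, unbounded rescaled profile) certificate would be a different thesis, filed as a card,
not a repair.
- Literature.Analysis.FluidPDE.AxisymmetricSwirlRegularity proved (owned by the positive-side
axisymmetric routes) ⇒ with X5b the
  landed theorem Literature.NS.certifiedBlowup_kill_edge gives ¬#2 ⇒ close
`refuted:CertifiedBlowupAxisymBlowup`.
- BlowupClayUniqueness (0153) refuted without a repaired statement ⇒ BROKEN: the glue to Clay (A) is
gone; repair only by
  restating #2 directly in the Clay class (no smooth bounded-energy global solution from the datum),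
else close.
- NavierStokesRegularity proved by any positive route ⇒ moot (and #2, #3 refuted by `closes`
contraposed).

NOT DECOMPOSED YET. Everything numerical and the whole certificate layer: the profile data d
(symmetry tag, exponents c_l, c_ω as rationals,
spline/Chebyshev coefficient arrays, unstable-projection basis), the functional frame nsFrame and
the inequality list
Conditions_ns, the verifier, Hou's scenario parameters, the far-field/portability estimate (cylinder
{r<1}×ℝ/Lℤ → compactly
supported datum on ℝ³; finite speed of propagation is false for NS, CKN-type ε-regularity outside a
ball is the tool). They are
layer-2 children of #3 (Two-layer plan) once nsFrame exists; filing them now would re-create the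
vacuous frame-quantified items.
Also not decomposed: #4 (its natural split — compactness along Seregin's Euler scaling → swirl-free
ancient Euler limit →
Liouville/rigidity of that limit under the vorticity-rate bound — is a tenure decision after a
prover's census).

CHEAPEST FALSIFIER. Check whether the vorticity rate of #3 is ALREADY a known Type I condition: (i)
KNSS2009 Thms 1.1–1.2 need |u| ≤ C(T−t)^(−1/2) or
|u| ≤ C/r — from (T−t)‖ω‖_∞ ≤ C and bounded energy, interpolation only gives ‖u‖_∞ ≲
‖u‖₂^(2/5)‖ω‖_∞^(3/5) ~ (T−t)^(−3/5), so
no; (ii) Seregin2020 needs g = inf{limsup A, E, C} < ∞ — in the class with core scale (T−t)^β, β <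
1/2, the planner's scaling
check gives A ~ r^(4−2/β), E ~ r^(2−1/β), C ~ r^(4−2/β), all divergent as r ↓ 0, so no. A refuter
who finds either computation
wrong (or a printed theorem excluding vorticity-Type-I axisymmetric blow-up outright, e.g. in
Seregin2026 beyond Thm 2.1's
hypotheses (1.7)+(2.4)) kills #3 and the method at once — that lookup/computation is the first thing
to run.

NUMBERS. - Collapse exponent β = c_l/|c_ω| (core scale (T−t)^β at vorticity rate (T−t)^(−1)): β =
1/2 exactly self-similar — excluded
  (velocity Type I: KochNadirashviliSereginSverak2009; finite local energy profiles:
NecasRuzickaSverak1996 / Tsai1998 in tree as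
  necas_ruzicka_sverak, tsai_selfsimilar*); bounded energy ∫|u|² ≳ l⁵/(T−t)² forces β ≥ 2/5; so β ∈
[2/5, 1/2).
- In the class: ‖u(t)‖_∞ ~ (T−t)^(β−1) (Type II), ‖u(t)‖_(L³) ~ (T−t)^(2β−1) → ∞ (consistent with
EscauriazaSereginSverak2003),
  rescaled viscosity ν(T−t)^(1−2β) → 0 (asymptotically inviscid).
- Hou2022PotentiallySingularNS fitted growth sits at the endpoint β = 1/2 (KNSS-forbidden); Hou2026
(doi:10.1007/s10208-026-09748-8)
  certifies nearly self-similar blow-up only for a generalised (dimension-modified) axisymmetric NS.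

DEFINITION REQUESTS. None new at this revision. Landed: Literature.NS.BlowupProfileData,
Literature.NS.StabilityFrame, Literature.NS.BlowupProfileConditions
(Theorems/CertifiedBlowupProfileData.lean, CertifiedBlowupConditions.lean — used by
CertifiedBlowupEnergyBootstrap). Wanted later
(tenure, not filed now): a CANONICAL nsFrame (definition item) before the Two-layer plan children of
#3 can be typed.

Novelty: Searches (2026-08-15; opener + repair seats g4/g5/g6). g6 (this revision): `lit frontier
NavierStokesRegularity --since 2025` (30 rows: on point only Hou2026 =
doi:10.1007/s10208-026-09748-8; unrefereed axisymmetric-regularity claims arXiv:2605.09797,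
arXiv:2605.01875, arXiv:2605.01873 noted, not used; nothing on vorticity-rate exclusion); `lit
galaxy search "nearly self-similar blowup" --star all` (0 panama / 6 pdf / 0 crabby: Cadiot
arXiv:2505.03091 CAP stability methodology, Chen arXiv:2408.04319 compressible Euler, Chen
arXiv:2309.00150 — none on constant-ν NS); `lit galaxy search "Type II blowup" --star pdf` (3: wave
/ drift-diffusion / ODE, none NS); `ledger negatives --problem NavierStokesRegularity` (0 refuted
statements, 18:40Z); `lit search` ×3 and `lit vsearch` returned searchd-unavailable / 0 docs at
18:35–18:45Z (rc 75; recorded, nothing claimed from them); `lean check` of all 9 items + `closes`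
over the trimmed imports (rc 0). g5: `lit search --source arxiv` "nearly self-similar blowup
axisymmetric Navier-Stokes" (1: arXiv:2405.10916), "potential singularity 3D Navier-Stokes equations
Hou" (4: arXiv:2107.06509, arXiv:2107.05870, Barker arXiv:2510.20757, PINNs arXiv:2506.19243), "Type
II blowup axisymmetric Navier-Stokes" (1: arXiv:2402.13229), "unstable self-similar solutions
Navier-Stokes singularities discovery" (1: arXiv:2509.14185), "singularity Navier-Stokes
axisymmetric swirl" (14); `lit read arxiv:2402.13229` pp. 1–3 (Type I := g = inf{limsup A, E, C} < ∞  [refs: 10.1007/s10208-026-09748-8, 2605.09797, 2605.01875, 2605.01873, 2505.03091, 2408.04319, 2309.00150, 2405.10916, 2107.06509, 2107.05870, 2510.20757, 2506.19243, 2402.13229, 2509.14185, 2606.29468, 2604.09949, 2509.25116, doi:10.1007/s10208-026-09748-8, arxiv:2402.13229, arxiv:2606.29468, arxiv:2604.09949, arxiv:2107.06509, Hou2026, Seregin2020, Seregin2026, MajdaBertozzi2002, LemarieRieusset2016, K]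

Barriers (technique_class: certified-numerics, dynamic-rescaling, blowup-construction): - technique_class: certified-numerics, dynamic-rescaling, blowup-construction
- Literature.Barriers.NavierStokesRegularity.LeraySelfSimilarBlowupExclusion: evaded — no exactly
self-similar Leray profile (β = 1/2, finite local energy) is admitted: KNSS2009 forces β = c_l/|c_ω|
< 1/2, so the certificate is a modulated nearly self-similar profile with rescaled viscosity → 0,
outside the NecasRuzickaSverak1996 / Tsai1998 ansatz (in tree and proved:
necas_ruzicka_sverak_holds, tsai_selfsimilar_holds; also why arXiv:2604.09949 is discarded).
- Literature.Barriers.NavierStokesRegularity.AxisymmetricTypeIExclusion: not evaded but USED (proved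
in tree: AxisymmetricTypeIExclusion_holds) — SereginSverak2009 Thm 3.1 / KNSS2009 Thm 6.2 (+
Seregin2020 for the scaled-energy form) is what makes the class velocity-Type-II and
vorticity-Type-I (β < 1/2) and types #3/#4; the bet of #3 is that vorticity-Type-I is NOT excluded
by the same compactness + Liouville argument (the NS-scaling zoom of such a solution is unbounded;
only Seregin's Euler scaling sees a limit, and that limit is swirl-free Euler, not a contradiction —
Seregin2026 Thm 3.1); the bet of #4 is that the Euler-scaling window closes.
- Literature.Barriers.NavierStokesRegularity.CriticalNormBlowupNecessity: met, not evaded — in the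
class ‖u(t)‖_(L³) → ∞ polynomially ((T−t)^(2β−1) on the core), consistent with
EscauriazaSereginSverak2003; no L³-bounded ansatz is used.
- Literature.Barriers.NavierStokesRegularity.SingularSetDimensionB

History (route lifecycle, newest last):
- 2026-08-16T02:17:19Z · AUTO-CRUX: 2 conjecture-grade item(s) promoted to crux (CertifiedBlowupKillEdge, AxisymmetricSwirlRegularityWall) — refuter vetting / tiering apply (operator:999:1362873)
- 2026-08-16T14:43:05Z · LINT AUTOFIX route.multi-assembly: kept Assembly, dropped Assembly2 (gate:hygiene)
- 2026-08-25T05:29:14Z · DORMANT — reconciler: no traction for 7.4 d (last activity item-evidence-added at 2026-08-17T19:02:18Z); parked, not closed — `ledger route dormant route-NavierStokesRegu (operator:999:2079606)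
- 2026-08-27T09:58:26Z · REACTIVATED — reconciler: reactivated — activity statement-checked at 2026-08-27T08:43:22Z after parking at 2026-08-25T05:29:14Z (operator:999:2055176)
- 2026-09-01T12:52:31Z · DORMANT — reconciler: no traction for 5 d (last activity statement-checked at 2026-08-27T12:19:12Z); parked, not closed — `ledger route dormant route-NavierStokesRegulari (operator:999:432952)

sub-problem: NavierStokesRegularity · status: dormant · opened planner-NavierStokesRegularity-Survey-0 2026-08-13T06:08:30Z · rev 14 · ledger route-NavierStokesRegularity-CertifiedBlowup
GENERATED by the gate from the ledger (D-0016/17). Provers cite these decls: `theorem foo : Summit.NavierStokesRegularity.NavierStokesRegularity.Theses.CertifiedBlowup.<Decl> := …` in Summits/NavierStokesRegularity/NavierStokesRegularity/Theorems/<Name>.lean.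
-/

namespace Summit.NavierStokesRegularity.NavierStokesRegularity.Theses.CertifiedBlowup

open scoped BigOperators Topology Manifold Classical MeasureTheory ProbabilityTheory Matrix InnerProductSpace ComplexConjugate ContinuousMap
open Filter Set Function TopologicalSpace MeasureTheory

attribute [summit_statement] _root_.NavierStokesRegularity

open Literature.NS

/-! Retired items kept as plain definitions (history; not obligations of this route): landed proofs / closed glue still name them. -/

-- tombstone: stmt-NavierStokesRegularity-0726 was DROPPED from this route but is still named by active items / landed proofs — kept as a plain def (no route_item tag), not an obligation of this route
/-- retired stmt-NavierStokesRegularity-0726 (dropped, gen None) — proved by Literature.NS.certifiedBlowup_assembly_v2. -/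
def Assembly2 : Prop :=
  ((∃ ν : ℝ, 0 < ν ∧ ∃ T : ℝ, 0 < T ∧ ∃ (u : ℝ → EuclideanSpace ℝ (Fin 3) → EuclideanSpace ℝ (Fin 3)) (p : ℝ → EuclideanSpace ℝ (Fin 3) → ℝ), Literature.Analysis.FluidPDE.IsMaximalSmoothSolution ν 0 u p T ∧ Literature.Analysis.FluidPDE.IsLerayHopfOn T ν 0 (u 0) u ∧ Literature.Analysis.FluidPDE.HasRapidSpatialDecay (u 0) ∧ Literature.Analysis.FluidPDE.IsAxisymmetric (u 0)) ∧ (∀ ν : ℝ, 0 < ν → ∀ (u₀ : EuclideanSpace ℝ (Fin 3) → EuclideanSpace ℝ (Fin 3)), Literature.Analysis.FluidPDE.HasRapidSpatialDecay u₀ → ∀ (u v : ℝ → EuclideanSpace ℝ (Fin 3) → EuclideanSpace ℝ (Fin 3)) (p q : ℝ → EuclideanSpace ℝ (Fin 3) → ℝ) (T : ℝ), 0 < T → Literature.Analysis.FluidPDE.IsSmoothOnHalfSpace u → Literature.Analysis.FluidPDE.IsSmoothOnHalfSpace p → Literature.Analysis.FluidPDE.IsNavierStokesSolution ν 0 u₀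 u p → Literature.Analysis.FluidPDE.HasBoundedEnergy u → Literature.Analysis.FluidPDE.IsClassicalNSSolutionOn (Set.Ico 0 T) ν 0 v q → Literature.Analysis.FluidPDE.IsLerayHopfOn T ν 0 u₀ v → v 0 = u₀ → ∀ t ∈ Set.Ico 0 T, u t = v t)) → ¬ NavierStokesRegularity

/-- item stmt-NavierStokesRegularity-0725 · target · rank 0 · open · by planner
why it might fail: the open conjecture Literature.Analysis.FluidPDE.AxisymmetricSwirlRegularity together with X5b refutes X (landed theorem Literature.NS.certifiedBlowup_kill_edge); constant-ν numerics are inconclusive (Hou2022 sits at the KNSS-forbidden endpoint β = 1/2; Hou2026 alters the equation).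
sources: KochNadirashviliSereginSverak2009, Hou2022PotentiallySingularNS, Hou2026, Fefferman2000, arXiv:2107.06509
Re-framed thesis (supersedes informal stmt-NavierStokesRegularity-0268, whose (∃ d, Conditions d) ∧
X5b did not feed the assembly — refuter g3-0): X := X5a_axi ∧ X5b. X5a_axi = finite-time blow-up of
the Leray–Hopf classical solution from some rapidly decaying AXISYMMETRIC datum (Hou's interior
tornado scenario arXiv:2107.06509, the target of the certified computation); X5b = Clay-class
uniqueness, verbatim stmt-NavierStokesRegularity-0153. The certificate (∃ d :
Literature.NS.BlowupProfileData, Literature.NS.BlowupProfileConditions d, stmt-…-0270) and the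
analytic implication (0269, to be typed '(∃ d, Conditions d) → X5a_axi' once def wi-03627 lands) are
the METHOD for X5a_axi, kept as cruxes #3/#4. Kill:
Literature.Analysis.FluidPDE.AxisymmetricSwirlRegularity together with X5b refutes X. [sources:
arXiv:2107.06509, ChenHou2022, KNSS2009, Fefferman2000] -/
@[route_item "route-NavierStokesRegularity-CertifiedBlowup"]
def CertifiedBlowupThesisV2 : Prop :=
  (∃ ν : ℝ, 0 < ν ∧ ∃ T : ℝ, 0 < T ∧ ∃ (u : ℝ → EuclideanSpace ℝ (Fin 3) → EuclideanSpace ℝ (Fin 3)) (p : ℝ → EuclideanSpace ℝ (Fin 3) → ℝ), Literature.Analysis.FluidPDE.IsMaximalSmoothSolution ν 0 u p T ∧ Literature.Analysis.FluidPDE.IsLerayHopfOn T ν 0 (u 0) u ∧ Literature.Analysis.FluidPDE.HasRapidSpatialDecay (u 0) ∧ Literature.Analysis.FluidPDE.IsAxisymmetric (u 0)) ∧ (∀ ν : ℝ, 0 < ν → ∀ (u₀ : EuclideanSpace ℝ (Fin 3) → EuclideanSpace ℝ (Fin 3)), Literature.Analysis.FluidPDE.HasRapidSpatialDecay u₀ →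 ∀ (u v : ℝ → EuclideanSpace ℝ (Fin 3) → EuclideanSpace ℝ (Fin 3)) (p q : ℝ → EuclideanSpace ℝ (Fin 3) → ℝ) (T : ℝ), 0 < T → Literature.Analysis.FluidPDE.IsSmoothOnHalfSpace u → Literature.Analysis.FluidPDE.IsSmoothOnHalfSpace p → Literature.Analysis.FluidPDE.IsNavierStokesSolution ν 0 u₀ u p → Literature.Analysis.FluidPDE.HasBoundedEnergy u → Literature.Analysis.FluidPDE.IsClassicalNSSolutionOn (Set.Ico 0 T) ν 0 v q → Literature.Analysis.FluidPDE.IsLerayHopfOn T ν 0 u₀ v → v 0 = u₀ → ∀ t ∈ Set.Ico 0 T, u t = v t)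

/-- item stmt-NavierStokesRegularity-0727 · crux · rank 2 · open · by planner
why it might fail: NS may simply be regular for axisymmetric data (conjecture AxisymmetricSwirlRegularity, ns.S25); printed mechanisms stop short: Elgindi2021 needs C^(1,α) data, ChenHou2025 a boundary, Hou2022's fitted growth sits at the KNSS-forbidden endpoint β = 1/2, Hou2026 changes the equation.
sources: KochNadirashviliSereginSverak2009, Hou2022PotentiallySingularNS, Hou2026, ChenHou2025, Elgindi2021, arXiv:2107.06509
X5a_axi: ∃ ν>0, T∈(0,∞) and a classical NS solution (u,p) on ℝ³×[0,T), Leray–Hopf on [0,T), with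
u(0) rapidly decaying AND axisymmetric (Literature.Analysis.FluidPDE.IsAxisymmetric), admitting no
classical extension past T. Strictly stronger than X5a (stmt-NavierStokesRegularity-0152, route
Blowup); isolates the scenario the certified computation targets: Hou's axisymmetric interior nearly
self-similar candidate (arXiv:2107.06509; NB Hou's NS numerics use a degenerate variable viscosity —
constant ν is the claim here), Euler analogue with boundary is a theorem
(Literature.Analysis.FluidPDE.chen_hou_blowup, ChenHou2022). Constraints any construction must
respect: no-swirl data are globally regular
(Literature.Analysis.FluidPDE.axisymmetric_no_swirl_global_regularity) so swirl is essential;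
axisymmetric Type I blow-up is excluded (Literature.Analysis.FluidPDE.knss_no_axisymmetric_typeI,
KNSS2009; Seregin–Šverák 2009) so the rate must be Type II; exactly self-similar finite-local-energy
profiles excluded (necas_ruzicka_sverak, tsai_selfsimilar). Negation follows from the wall
Literature.Analysis.FluidPDE.AxisymmetricSwirlRegularity given X5b. [sources: arXiv:2107.06509,
ChenHou2022, K -/
@[route_item "route-NavierStokesRegularity-CertifiedBlowup", crux]
def CertifiedBlowupAxisymBlowup : Prop :=
  ∃ ν : ℝ, 0 < ν ∧ ∃ T : ℝ, 0 < T ∧ ∃ (u : ℝ → EuclideanSpace ℝ (Fin 3) → EuclideanSpace ℝ (Fin 3)) (p : ℝ → EuclideanSpace ℝ (Fin 3) → ℝ), Literature.Analysis.FluidPDE.IsMaximalSmoothSolution ν 0 u p T ∧ Literature.Analysis.FluidPDE.IsLerayHopfOn T ν 0 (u 0) u ∧ Literature.Analysis.FluidPDE.HasRapidSpatialDecay (u 0) ∧ Literature.Analysis.FluidPDE.IsAxisymmetric (u 0)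

-- item stmt-NavierStokesRegularity-0268 · support · rank 0 · open · by planner — informal only, no Lean statement yet:
--   X := (∃ d : Literature.NS.BlowupProfileData, Literature.NS.BlowupProfileConditions d) ∧ X5b, with
--   X5b verbatim the signature of stmt-NavierStokesRegularity-0153. structure
--   Literature.NS.BlowupProfileData: finite rational data — symmetry class tag (axisymmetric;
--   with/without swirl parity), dynamic-rescaling exponents (c_l, c_ω) as rationals, a tensor-product
--   spline/Chebyshev coefficient array for the approximate profile (velocity/vorticity components in
--   similarity variables on a truncated domain), the rank and rational basis coefficients of the
--   finite-dimensional unstable/neutral projection, an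

-- item stmt-NavierStokesRegularity-0269 · support · rank 2 · open · by planner — informal only, no Lean statement yet:
--   ∀ d, Literature.NS.BlowupProfileConditions d → X5a, X5a verbatim the signature of
--   stmt-NavierStokesRegularity-0152: ∃ ν : ℝ, 0 < ν ∧ ∃ T : ℝ, 0 < T ∧ ∃ (u : ℝ → EuclideanSpace ℝ (Fin
--   3) → EuclideanSpace ℝ (Fin 3)) (p : ℝ → EuclideanSpace ℝ (Fin 3) → ℝ),
--   Literature.Analysis.FluidPDE.IsMaximalSmoothSolution ν 0 u p T ∧
--   Literature.Analysis.FluidPDE.IsLerayHopfOn T ν 0 (u 0) u ∧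
--   Literature.Analysis.FluidPDE.HasRapidSpatialDecay (u 0). Content: nonlinear stability of the
--   approximate (nearly) self-similar profile in dynamic-rescaling coordinates FOR NAVIER–STOKES — the
--   viscous term is critical under

-- item stmt-NavierStokesRegularity-0270 · support · rank 3 · open · by planner — informal only, no Lean statement yet:
--   ∃ d : Literature.NS.BlowupProfileData, Literature.NS.BlowupProfileConditions d — to be discharged as
--   V.claim c h for a sound checker V : Literature.Analysis.ValidatedNumerics.Verifier
--   Literature.NS.BlowupProfileData Literature.NS.BlowupProfileConditions
--   (Literature/Analysis/ValidatedNumerics/Certificate.lean pattern) and an explicit certificate c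
--   (profile computed externally à la Hou arXiv:2107.06509 / Chen–Hou arXiv:2210.07191, verified
--   in-kernel or by native_decide at the operator's discretion). [sources: arXiv:2107.06509,
--   arXiv:2210.07191, arXiv:2305.05660] [needs_definition: Literature.NS.

/-- item stmt-NavierStokesRegularity-8639 · aside · rank 3 · open · by planner
why it might fail: squeezed into β = c_l/|c_ω| ∈ [2/5,1/2) (energy; KNSS2009 + Seregin2020: no Type I): asymptotically inviscid, Kelvin's r·u_θ bound makes the Euler-scaling limit swirl-free (Seregin2024AxisymTypeII, Seregin2026 §4), excluded under his (1.7)+(2.4); Hou2022 sits at β = 1/2.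
sources: KochNadirashviliSereginSverak2009, Seregin2020, Seregin2024AxisymTypeII, Seregin2026, arXiv:2606.29468, Hou2022PotentiallySingularNS
[crux] the CERTIFICATE CLASS: for some ν>0 a Leray–Hopf classical solution from a rapidly decaying
axisymmetric datum is maximal with finite lifespan T and obeys the dynamic-rescaling rate
(T−t)‖ω(t)‖_∞ ≤ C as t ↑ T — what any Chen–Hou-type certificate with bounded rescaled profile and
c_ω < 0 delivers (C_ω(τ) ≍ |c_ω|(T−t)). [difficulty: open-problem] Why it might fail: squeezed:
KNSS2009 forces β=c_l/|c_ω|<1/2 (asymptotically inviscid); Kelvin's bound on r·u_θ then removes the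
swirl from the rescaled limit (Seregin arXiv:2402.13229: no-swirl Euler limit, excluded under his
Prop 2.3 conditions); Hou2022 sits at β=1/2. [sources: KochNadirashviliSereginSverak2009,
Seregin2024AxisymTypeII, Hou2022PotentiallySingularNS, ChenHou2022, ChaeShvydkoy2013] -/
@[route_item "route-NavierStokesRegularity-CertifiedBlowup"]
def CertifiedBlowupVorticityRateBlowup : Prop :=
  ∃ ν : ℝ, 0 < ν ∧ ∃ T : ℝ, 0 < T ∧ ∃ (u : ℝ → EuclideanSpace ℝ (Fin 3) → EuclideanSpace ℝ (Fin 3)) (p : ℝ → EuclideanSpace ℝ (Fin 3) → ℝ), Literature.Analysis.FluidPDE.IsMaximalSmoothSolution ν 0 u p T ∧ Literature.Analysis.FluidPDE.IsLerayHopfOn T ν 0 (u 0) u ∧ Literature.Analysis.FluidPDE.HasRapidSpatialDecay (u 0) ∧ Literature.Analysis.FluidPDE.IsAxisymmetric (u 0) ∧ ∃ C : ℝ, ∀ᶠ t in nhdsWithin T (Set.Iio T), ∀ x : EuclideanSpace ℝ (Fin 3), (T - t) * ‖Literature.Analysis.FluidPDE.curl (u t) x‖ ≤ C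

/-- item stmt-NavierStokesRegularity-0153 · support · rank 4 · closed · proved by Summit.NavierStokesRegularity.NavierStokesRegularity.Theorems.adiabaticEddy_clayUniqueness_proof @ bd26efe366a2 (prover) · by planner
why it might fail: smooth + sup_t ∫|u|² < ∞ gives neither the global energy inequality nor LPS integrability (u(t) may be unbounded at spatial infinity, ∫∫|∇u|² may diverge), so weak–strong uniqueness does not apply as printed; the pressure needs a Liouville normalisation first.
sources: Fefferman2000, Prodi1959, Serrin1963, LemarieRieusset2016
Fefferman's class (A) = jointly C^∞ on ℝ³×[0,∞) + sup_t ∫|u|² < ∞; no energy inequality, no decay of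
∇u, no integrability in LPS scales is assumed. Claim: such (u,p) coincides on [0,T) with any
Leray–Hopf classical solution v from the same rapidly decaying datum. Expected route: smoothness +
bounded energy ⇒ u is a distributional solution with locally finite dissipation?? (NOT automatic:
∫∫|∇u|² may be infinite) — this is exactly the delicate point; alternatives: Liouville-type control
of the pressure (p harmonic part must be affine ⇒ excluded by bounded energy), then local energy
inequality, then weak–strong uniqueness (Prodi 1959, Serrin 1963) against v which is in every LPS
class on compacts of [0,T). [sources: Prodi1959, Serrin1963, Fefferman2000, LemarieRieusset2002,
RobinsonRodrigoSadowski2016] -/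
@[route_item "route-NavierStokesRegularity-CertifiedBlowup", crux]
def BlowupClayUniqueness : Prop :=
  ∀ ν : ℝ, 0 < ν → ∀ (u₀ : EuclideanSpace ℝ (Fin 3) → EuclideanSpace ℝ (Fin 3)), Literature.Analysis.FluidPDE.HasRapidSpatialDecay u₀ → ∀ (u v : ℝ → EuclideanSpace ℝ (Fin 3) → EuclideanSpace ℝ (Fin 3)) (p q : ℝ → EuclideanSpace ℝ (Fin 3) → ℝ) (T : ℝ), 0 < T → Literature.Analysis.FluidPDE.IsSmoothOnHalfSpace u → Literature.Analysis.FluidPDE.IsSmoothOnHalfSpace p → Literature.Analysis.FluidPDE.IsNavierStokesSolution ν 0 u₀ u p → Literature.Analysis.FluidPDE.HasBoundedEnergy u → Literature.Analysis.FluidPDE.IsClassicalNSSolutionOn (Set.Ico 0 T) ν 0 v q → Literature.Analysis.FluidPDE.IsLerayHopfOn T ν 0 u₀ v → v 0 = u₀ → ∀ t ∈ Set.Ico 0 T, u t = v t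

/-- `BlowupClayUniqueness` holds: proved by `Summit.NavierStokesRegularity.NavierStokesRegularity.Theorems.adiabaticEddy_clayUniqueness_proof` @ bd26efe366a2. -/
theorem BlowupClayUniqueness_holds : BlowupClayUniqueness := _root_.Summit.NavierStokesRegularity.NavierStokesRegularity.Theorems.adiabaticEddy_clayUniqueness_proof

/-- item stmt-NavierStokesRegularity-8640 · aside · rank 4 · open · by planner
why it might fail: a slow-collapse scenario β ∈ [2/5,1/2), swirl-free only at leading order (Elgindi-type C^(1,α) Euler limit), passes the energy, CKN, KNSS and Kelvin budgets; Seregin2026 Thm 2.1 excludes it only under (1.7)+(2.4) — otherwise Thm 3.1 just yields a non-trivial ancient Euler limit.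
sources: Seregin2024AxisymTypeII, Seregin2024, Seregin2026, arXiv:2606.29468, KochNadirashviliSereginSverak2009, LeiZhang2017
[crux] the typed KILL statement (¬#3 up to logic, see CertifiedBlowupRateDichotomy): every
Leray–Hopf classical solution from a rapidly decaying axisymmetric datum that is maximal with finite
lifespan T is super-Type-I in vorticity, limsup_{t↑T} (T−t)‖ω(t)‖_∞ = ∞ — a strengthening of
KNSS2009 (velocity Type I excluded) along Seregin's Euler scaling; proved, it empties the
certificate class and closes the route refuted:#3. [difficulty: L] Why it might fail: a
slow-collapse Type II scenario with β ∈ [2/5,1/2) (Seregin's α ∈ (1,3/2]), swirl-free only at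
leading order, passes the energy, dissipation, CKN, KNSS and Kelvin budgets; Seregin2024AxisymTypeII
excludes it only under extra integrability conditions. [sources: Seregin2024AxisymTypeII,
Seregin2024, KochNadirashviliSereginSverak2009, LeiZhang2017, ChaeShvydkoy2013] -/
@[route_item "route-NavierStokesRegularity-CertifiedBlowup"]
def CertifiedBlowupVorticityRateExclusion : Prop :=
  ∀ ν : ℝ, 0 < ν → ∀ T : ℝ, 0 < T → ∀ (u : ℝ → EuclideanSpace ℝ (Fin 3) → EuclideanSpace ℝ (Fin 3)) (p : ℝ → EuclideanSpace ℝ (Fin 3) → ℝ), Literature.Analysis.FluidPDE.IsMaximalSmoothSolution ν 0 u p T → Literature.Analysis.FluidPDE.IsLerayHopfOn T ν 0 (u 0) u → Literature.Analysis.FluidPDE.HasRapidSpatialDecay (u 0) → Literature.Analysis.FluidPDE.IsAxisymmetric (u 0) → ∀ C : ℝ, ∃ᶠ t in nhdsWithin T (Set.Iio T), ∃ x : EuclideanSpace ℝ (Fin 3), C < (T - t) * ‖Literature.Analysis.FluidPDE.curl (u t) x‖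

-- item stmt-NavierStokesRegularity-0271 · support · rank 5 · open · by planner — informal only, no Lean statement yet:
--   If an axisymmetric NS blow-up is certified in {r<1}×(ℝ/Lℤ) (slip or periodic conditions) with the
--   singular point at positive distance from the boundary and with quantitative stability margin δ in
--   the certificate norm, then some smooth compactly supported divergence-free datum on ℝ³ (Schwartz,
--   satisfies HasRapidSpatialDecay) yields X5a. Needs far-field control replacing finite speed of
--   propagation: ε-regularity outside a ball (CKN 1982) and smallness of the interaction in the
--   certificate's weighted norms. Informal until BlowupProfileConditions is defined. [sources: CKN1982,
--   ChenHou2022, arXiv:2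

/-- item stmt-NavierStokesRegularity-0729 · banked (kind.auto-crux: conjecture-grade) · rank 6 · closed · proved by Literature.NS.certifiedBlowup_kill_edge (refuter) · by planner
why it might fail: auto-crux — conjecture-grade statement (statement references the registered conjecture Literature.Analysis.FluidPDE.AxisymmetricSwirlRegularity); it is open, so it may simply be false
sources: conjecture-registry
Kill edge of thesis v2 (stmt-NavierStokesRegularity-0725), typed: the open wall
Literature.Analysis.FluidPDE.AxisymmetricSwirlRegularity (global classical bounded-energy solutions
from rapidly decaying axisymmetric data; SelfSimilarLiouville.lean:337, KNSS2009 §5) together with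
Clay-class uniqueness X5b (0153 verbatim) refutes X5a_axi (0727 verbatim). Formal glue, same 8 lines
as Literature.NS.blowup_assembly: from the X5a_axi witness (ν,T,u,p) apply
AxisymmetricSwirlRegularity to u 0 (smooth and div-free from IsClassicalNSSolutionOn at t=0,
decaying and axisymmetric by hypothesis) to get a global classical (U,P) on Ici 0 with U 0 = u 0 and
HasBoundedEnergy U; convert to the Clay predicate by
Literature.Analysis.FluidPDE.isNavierStokesSolution_and_smooth_iff (←); X5b gives U = u on Ico 0 T;
IsClassicalNSSolutionOn.mono to Ico 0 (T+1) yields HasSmoothExtensionPast, contradicting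
IsMaximalSmoothSolution. Records in Lean which open regularity statement kills route CertifiedBlowup
(and, dropping IsAxisymmetric, NavierStokesRegularity itself kills X5a: that is blowup_assembly
contraposed). Cheap prover target (3 grounders g6-0/g6-1/g6-2 asked for it typed). [sources:
KNSS2009, Fefferman -/
@[route_item "route-NavierStokesRegularity-CertifiedBlowup"]
def CertifiedBlowupKillEdge : Prop :=
  Literature.Analysis.FluidPDE.AxisymmetricSwirlRegularity → (∀ ν : ℝ, 0 < ν → ∀ (u₀ : EuclideanSpace ℝ (Fin 3) → EuclideanSpace ℝ (Fin 3)), Literature.Analysis.FluidPDE.HasRapidSpatialDecay u₀ → ∀ (u v : ℝ → EuclideanSpace ℝ (Fin 3) → EuclideanSpace ℝ (Fin 3)) (p q : ℝ → EuclideanSpace ℝ (Fin 3) → ℝ) (T : ℝ), 0 < T → Literature.Analysis.FluidPDE.IsSmoothOnHalfSpace u → Literature.Analysis.FluidPDE.IsSmoothOnHalfSpace p → Literature.Analysis.FluidPDE.IsNavierStokesSolution ν 0 u₀ u p → Literature.Analysis.FluidPDE.HasBoundedEnergy u → Literature.Analysis.FluidPDE.IsClassicalNSSolutionOn (Set.Ico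 0 T) ν 0 v q → Literature.Analysis.FluidPDE.IsLerayHopfOn T ν 0 u₀ v → v 0 = u₀ → ∀ t ∈ Set.Ico 0 T, u t = v t) → ¬ (∃ ν : ℝ, 0 < ν ∧ ∃ T : ℝ, 0 < T ∧ ∃ (u : ℝ → EuclideanSpace ℝ (Fin 3) → EuclideanSpace ℝ (Fin 3)) (p : ℝ → EuclideanSpace ℝ (Fin 3) → ℝ), Literature.Analysis.FluidPDE.IsMaximalSmoothSolution ν 0 u p T ∧ Literature.Analysis.FluidPDE.IsLerayHopfOn T ν 0 (u 0) u ∧ Literature.Analysis.FluidPDE.HasRapidSpatialDecay (u 0) ∧ Literature.Analysis.FluidPDE.IsAxisymmetric (u 0))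

/-- `CertifiedBlowupKillEdge` holds: proved by `Literature.NS.certifiedBlowup_kill_edge`. -/
theorem CertifiedBlowupKillEdge_holds : CertifiedBlowupKillEdge := _root_.Literature.NS.certifiedBlowup_kill_edge

/-- item stmt-NavierStokesRegularity-11332 · aside (kind.auto-crux: conjecture-grade) · rank 9 · open · by planner
why it might fail: It is the axisymmetric case of Clay (A) with swirl: open since Ladyzhenskaya / Ukhovskii–Yudovich 1968; every printed criterion needs extra smallness (LeiZhang2017) or Type-I rates (KNSS2009); Hou's scenario is a candidate counterexample.
sources: KochNadirashviliSereginSverak2009, LeiZhang2017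
[support] KILL WALL, declared as an item so that the conjecture leaf reached by the proved kill edge
is an item of this route (gate: undeclared-conjecture ⇒ not staffable; planner prompt 4b): the open
conjecture of GLOBAL REGULARITY FOR RAPIDLY DECAYING AXISYMMETRIC DATA WITH SWIRL (ns.S25; KNSS2009
§5–6; the no-swirl case is the theorem axisymmetric_no_swirl_global_regularity). This line does NOT
want it true: PROVED, it refutes crux #2 CertifiedBlowupAxisymBlowup and the target (with X5b)
through the proved CertifiedBlowupKillEdge = Literature.NS.certifiedBlowup_kill_edge ⇒ close the
route refuted:CertifiedBlowupAxisymBlowup; REFUTED, its negation is crux #2 up to Clay-class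
uniqueness / local well-posedness. Its proof is owned by the positive-side axisymmetric routes
(SwirlThreshold, SwirlSignGeometry, CirculationRelay, FlatSwirlGauge, …); rank 9 here, not staffed
by this route. [difficulty: open-problem] [sources: KochNadirashviliSereginSverak2009, LeiZhang2017,
ChenStrainTsaiYau2009] -/
@[route_item "route-NavierStokesRegularity-CertifiedBlowup"]
def AxisymmetricSwirlRegularityWall : Prop :=
  Literature.Analysis.FluidPDE.AxisymmetricSwirlRegularity

/-- item stmt-NavierStokesRegularity-8641 · support · rank 9 · closed · proved by Summit.NavierStokesRegularity.NavierStokesRegularity.Theorems.certifiedBlowup_rateGlue_proof @ a731a039747c (prover) · by planner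
sources: BealeKatoMajda1984
[support] #3 → #2 (forget the rate conjunct); pure logic, three lines (verified in the planner's
Sketch.lean). [difficulty: provable-now] [sources: BealeKatoMajda1984] -/
@[route_item "route-NavierStokesRegularity-CertifiedBlowup"]
def CertifiedBlowupRateGlue : Prop :=
  (∃ ν : ℝ, 0 < ν ∧ ∃ T : ℝ, 0 < T ∧ ∃ (u : ℝ → EuclideanSpace ℝ (Fin 3) → EuclideanSpace ℝ (Fin 3)) (p : ℝ → EuclideanSpace ℝ (Fin 3) → ℝ), Literature.Analysis.FluidPDE.IsMaximalSmoothSolution ν 0 u p T ∧ Literature.Analysis.FluidPDE.IsLerayHopfOn T ν 0 (u 0) u ∧ Literature.Analysis.FluidPDE.HasRapidSpatialDecay (u 0) ∧ Literature.Analysis.FluidPDE.IsAxisymmetric (u 0) ∧ ∃ C : ℝ, ∀ᶠ t in nhdsWithin T (Set.Iio T), ∀ x : EuclideanSpace ℝ (Fin 3), (T - t) * ‖Literature.Analysis.FluidPDE.curl (u t) x‖ ≤ C) → (∃ ν : ℝ, 0 < ν ∧ ∃ T : ℝ, 0 < T ∧ ∃ (u : ℝ → EuclideanSpace ℝ (Fin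 3) → EuclideanSpace ℝ (Fin 3)) (p : ℝ → EuclideanSpace ℝ (Fin 3) → ℝ), Literature.Analysis.FluidPDE.IsMaximalSmoothSolution ν 0 u p T ∧ Literature.Analysis.FluidPDE.IsLerayHopfOn T ν 0 (u 0) u ∧ Literature.Analysis.FluidPDE.HasRapidSpatialDecay (u 0) ∧ Literature.Analysis.FluidPDE.IsAxisymmetric (u 0))

-- `CertifiedBlowupRateGlue` holds: proved by `Summit.NavierStokesRegularity.NavierStokesRegularity.Theorems.certifiedBlowup_rateGlue_proof` @ a731a039747c (its module imports this route file, so no `_holds` link can be stated here).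

/-- item stmt-NavierStokesRegularity-8642 · support · rank 9 · closed · proved by Summit.NavierStokesRegularity.NavierStokesRegularity.Theorems.certifiedBlowupRateDichotomy_proof @ 4a5e4427826e (prover) · by planner
sources: KochNadirashviliSereginSverak2009
[support] #4 ↔ ¬#3 (push the negation through ∃/∀ᶠ/∀); pure logic (verified in the planner's
Sketch.lean), so that a proof of #4 closes #3 as refuted in one line and vice versa. [difficulty:
provable-now] [sources: KochNadirashviliSereginSverak2009] -/
@[route_item "route-NavierStokesRegularity-CertifiedBlowup"]
def CertifiedBlowupRateDichotomy : Prop :=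
  (∀ ν : ℝ, 0 < ν → ∀ T : ℝ, 0 < T → ∀ (u : ℝ → EuclideanSpace ℝ (Fin 3) → EuclideanSpace ℝ (Fin 3)) (p : ℝ → EuclideanSpace ℝ (Fin 3) → ℝ), Literature.Analysis.FluidPDE.IsMaximalSmoothSolution ν 0 u p T → Literature.Analysis.FluidPDE.IsLerayHopfOn T ν 0 (u 0) u → Literature.Analysis.FluidPDE.HasRapidSpatialDecay (u 0) → Literature.Analysis.FluidPDE.IsAxisymmetric (u 0) → ∀ C : ℝ, ∃ᶠ t in nhdsWithin T (Set.Iio T), ∃ x : EuclideanSpace ℝ (Fin 3), C < (T - t) * ‖Literature.Analysis.FluidPDE.curl (u t) x‖) ↔ ¬ (∃ ν : ℝ, 0 < ν ∧ ∃ T : ℝ, 0 < T ∧ ∃ (u : ℝ → EuclideanSpace ℝ (Fin 3) → EuclideanSpace ℝ (Fin 3)) (p : ℝ → EuclideanSpace ℝ (Fin 3) → ℝ), Literature.Analysis.FluidPDE.IsMaximalSmoothSolution ν 0 u p T ∧ Literature.Analysis.FluidPDE.IsLerayHopfOn T ν 0 (u 0) u ∧ Literature.Analysis.FluidPDE.HasRapidSpatialDecay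 (u 0) ∧ Literature.Analysis.FluidPDE.IsAxisymmetric (u 0) ∧ ∃ C : ℝ, ∀ᶠ t in nhdsWithin T (Set.Iio T), ∀ x : EuclideanSpace ℝ (Fin 3), (T - t) * ‖Literature.Analysis.FluidPDE.curl (u t) x‖ ≤ C)

-- `CertifiedBlowupRateDichotomy` holds: proved by `Summit.NavierStokesRegularity.NavierStokesRegularity.Theorems.certifiedBlowupRateDichotomy_proof` @ 4a5e4427826e (its module imports this route file, so no `_holds` link can be stated here).

/-- item stmt-NavierStokesRegularity-8643 · support · rank 9 · closed · proved by Summit.NavierStokesRegularity.NavierStokesRegularity.Theorems.certifiedBlowupEnergyBootstrap_proof @ 9a48f4541aec (prover) · by planner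
sources: ChenHou2022, ChenHou2023RigorousNumerics
[support] the frame-independent half of the certificate layer, provable now over the landed package
(Chen–Hou Part I, Lemma A.2, energy form): under Literature.NS.BlowupProfileConditions d F there is
a threshold E* > 0 (the one of energyRHS_neg) such that every trajectory v : [0,∞) → F.X staying in
F.unstableᗮ, whose energy ‖v‖²/2 has a derivative within [0,∞) bounded by linForm + Σ nonlinForms +
⟪residual, v⟫, and with ‖v 0‖ < E*, satisfies ‖v τ‖ < E* for all τ ≥ 0 (continuity/first-exit
argument). [difficulty: provable-now] [sources: ChenHou2022, ChenHou2023RigorousNumerics] -/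
@[route_item "route-NavierStokesRegularity-CertifiedBlowup"]
def CertifiedBlowupEnergyBootstrap : Prop :=
  ∀ (d : Literature.NS.BlowupProfileData) (F : Literature.NS.StabilityFrame d), Literature.NS.BlowupProfileConditions d F → ∃ Estar : ℝ, 0 < Estar ∧ ∀ v : ℝ → F.X, (∀ τ : ℝ, 0 ≤ τ → v τ ∈ F.unstableᗮ) → (∀ τ : ℝ, 0 ≤ τ → ∃ e : ℝ, HasDerivWithinAt (fun s => ‖v s‖ ^ 2 / 2) e (Set.Ici 0) τ ∧ e ≤ F.linForm (v τ) + F.totalNonlin (v τ) + inner ℝ F.residual (v τ)) → ‖v 0‖ < Estar → ∀ τ : ℝ, 0 ≤ τ → ‖v τ‖ < Estar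

-- `CertifiedBlowupEnergyBootstrap` holds: proved by `Summit.NavierStokesRegularity.NavierStokesRegularity.Theorems.certifiedBlowupEnergyBootstrap_proof` @ 9a48f4541aec (its module imports this route file, so no `_holds` link can be stated here).

/-- item stmt-NavierStokesRegularity-0151 · assembly · rank 1 · closed · proved by Literature.NS.blowup_assembly (refuter) · by planner
Formal: apply A to the datum u 0 of X5a (smooth by IsClassicalNSSolutionOn.contDiff_velocity,
div-free by Literature.Analysis.FluidPDE.NSWave0.IsDivFree =
Literature.Analysis.FluidPDE.VectorCalculus.IsDivFree definitional shape, rapidly decaying by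
hypothesis) to get a global Clay solution; X5b identifies it with the blowing-up solution on [0,T);
Literature.Analysis.FluidPDE.isNavierStokesSolution_and_smooth_iff and IsClassicalNSSolutionOn.mono
to Ico 0 (T+1) give HasSmoothExtensionPast, contradicting IsMaximalSmoothSolution. [sources:
Fefferman2000, BealeKatoMajda1984] -/
@[route_item "route-NavierStokesRegularity-CertifiedBlowup"]
def Assembly : Prop :=
  ((∃ ν : ℝ, 0 < ν ∧ ∃ T : ℝ, 0 < T ∧ ∃ (u : ℝ → EuclideanSpace ℝ (Fin 3) → EuclideanSpace ℝ (Fin 3)) (p : ℝ → EuclideanSpace ℝ (Fin 3) → ℝ), Literature.Analysis.FluidPDE.IsMaximalSmoothSolution ν 0 u p T ∧ Literature.Analysis.FluidPDE.IsLerayHopfOn T ν 0 (u 0) u ∧ Literature.Analysis.FluidPDE.HasRapidSpatialDecay (u 0)) ∧ (∀ ν : ℝ, 0 < ν → ∀ (u₀ : EuclideanSpace ℝ (Fin 3) → EuclideanSpace ℝ (Fin 3)), Literature.Analysis.FluidPDE.HasRapidSpatialDecay u₀ → ∀ (u v : ℝ → EuclideanSpace ℝ (Fin 3) → EuclideanSpace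 ℝ (Fin 3)) (p q : ℝ → EuclideanSpace ℝ (Fin 3) → ℝ) (T : ℝ), 0 < T → Literature.Analysis.FluidPDE.IsSmoothOnHalfSpace u → Literature.Analysis.FluidPDE.IsSmoothOnHalfSpace p → Literature.Analysis.FluidPDE.IsNavierStokesSolution ν 0 u₀ u p → Literature.Analysis.FluidPDE.HasBoundedEnergy u → Literature.Analysis.FluidPDE.IsClassicalNSSolutionOn (Set.Ico 0 T) ν 0 v q → Literature.Analysis.FluidPDE.IsLerayHopfOn T ν 0 u₀ v → v 0 = u₀ → ∀ t ∈ Set.Ico 0 T, u t = v t)) → ¬ NavierStokesRegularity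

/-- `Assembly` holds: proved by `Literature.NS.blowup_assembly`. -/
theorem Assembly_holds : Assembly := _root_.Literature.NS.blowup_assembly

-- records of items no longer active in this route (dropped / restated):
-- earlier Assembly2 (stmt-NavierStokesRegularity-0726, dropped 2026-08-16T14:43:05Z): proved by Literature.NS.certifiedBlowup_assembly_v2 — ((∃ ν : ℝ, 0 < ν ∧ ∃ T : ℝ, 0 < T ∧ ∃ (u : ℝ → EuclideanSpace ℝ (Fin 3) → EuclideanSpace ℝ (Fin 3)) (p : ℝ → EuclideanSpace ℝ (Fin 3) → ℝ), Literature.Analysis.FluidPDE.IsMaximalSmoothSolution ν 0 u p T ∧ Literature.Analysis.FluidPDE.IsLerayHopfOn T ν 0 (u 0) u 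

/-! D-0027 §2.1 — DECIDING THEOREM (planner-authored via `route open/edit --closes-file`; by planner-rbadge-NavierStokesRegularity-Certifie-f8c932fd-g4-0 2026-08-15T17:00:24Z):
its hypotheses are this route's items and its conclusion the sub-problem Statement (glue_lint), and it elaborates with this file. -/

@[closes "route-NavierStokesRegularity-CertifiedBlowup"] theorem closes (hX : CertifiedBlowupAxisymBlowup) (hU : BlowupClayUniqueness) : ¬ _root_.NavierStokesRegularity := by
  intro hA
  obtain ⟨ν, hν, T, hT, u, p, ⟨hcl, hmax⟩, hLH, hdec, -⟩ := hX
  have h0 : (0 : ℝ) ∈ Set.Ico 0 T := ⟨le_rfl, hT⟩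
  obtain ⟨u', p', hu', hp', hns, hbe⟩ := hA ν hν (u 0) (hcl.contDiff_velocity h0) (hcl.divFree 0 h0) hdec
  have heq : ∀ t ∈ Set.Ico 0 T, u' t = u t := hU ν hν (u 0) hdec u' u p' p T hT hu' hp' hns hbe hcl hLH rfl
  have hcl' : Literature.Analysis.FluidPDE.IsClassicalNSSolutionOn (Set.Ici 0) ν 0 u' p' :=
    ⟨hu', hp', fun t ht x => hns.momentum t ht x, fun t ht => hns.divFree t ht⟩
  exact hmax ⟨T + 1, by linarith, u', p', hcl'.mono (fun t ht => ht.1) (uniqueDiffOn_Ico 0 (T + 1)), heq⟩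

end Summit.NavierStokesRegularity.NavierStokesRegularity.Theses.CertifiedBlowup
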